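import Literature.NumberTheory.LFunctions.SelbergClassZeroCounting
import Literature.Analysis.SpecialFunctions.DigammaStirlingSecondOrder
import Literature.Analysis.Complex.VerticalLineShift
import Mathlib.Analysis.SpecialFunctions.JapaneseBracket
import HarnessLib

/-!
# Strong multiplicity one for the Selberg class: the gamma-factor term `H_F − H_G` ((8) of the source)

Layer 7 of the formalisation of K. Soundararajan, *Strong multiplicity one for the Selberg class*,
Canad. Math. Bull. 47 (2004) 468–474 = arXiv:math/0210299 (named fact
`Literature.NumberTheory.LFunctions.Soundararajan2004_strongMultiplicityOne_thinSet`). Pure proof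
file (theorems only). It evaluates the gamma-factor ("archimedean") term of the pair explicit formula
with a test function `h(L(· − t₀))`, `h` real on `ℝ` with `‖h(z)‖ ≤ C e^{|im z|}/(1+|re z|)^N`:

* `Soundararajan2004.abs_log_one_add_le`, `abs_log_norm_sub_log_le` — `|log(1+x)| ≤ 2|x|`, and the
  logarithm of the modulus of a point near `ia`.
* `SelbergDatum.exists_re_digamma_factor_sub_le`, `exists_re_sum_digamma_sub_le` — **Stirling on the
  critical line**: `Re ∑ⱼ λⱼψ(λⱼ(1/2+iy)+μⱼ) = ∑ⱼ λⱼ log λⱼ + (d_F/2) log y + O(1/y)` (from the tree's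
  `Literature.Analysis.SpecialFunctions.Complex.norm_digamma_sub_log_add_inv_le`).
* `Soundararajan2004.integral_mul_scaled_eq` — the substitution `y = t₀ + u/L`.
* `Soundararajan2004.exists_gammaTerm_integral_sub_main_le` — **(8)**: for `T ≥ T₀`, `L ≥ 1`,
  `t₀ ∈ [T, 2T]`, `N ≥ 4`,
  `|L·Re ∫ (G_F − G_G)(1/2+iy) h(L(y−t₀)) dy − (∫h)·((d_F−d_G)/2 · log t₀ + κ)| ≤ C/T`,
  `κ = ∑ λⱼ log λⱼ − ∑ λ'ₖ log λ'ₖ` (the source: "`H_F(t,L) = g(0) d_F log T/L + O(1/L)`").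
* `Soundararajan2004.integral_gammaTerm_vertical_shift` — the gamma-term integral on the line
  `re s = 1/2 + η` of the explicit-formula rectangle equals the one on `re s = 1/2`
  (`Literature.Analysis.Complex.integral_vertical_eq_of_differentiableOn`; `G` is analytic on
  `re s > 0` and `O(log|im s|)`, the kernel decays like `(1 + L|im s − t₀|)^{-N}`).

## References

* K. Soundararajan, *Strong multiplicity one for the Selberg class*, Canad. Math. Bull. 47 (2004)
  468–474; arXiv:math/0210299, displays (7), (8). [Soundararajan2002]
-/

noncomputable section

open Complex Filter Topology Set MeasureTheory
open scoped ComplexConjugate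

namespace Literature.NumberTheory.LFunctions

/-- `|log(1 + x)| ≤ 2|x|` for `|x| ≤ 1/2`. [folklore] -/
theorem Soundararajan2004.abs_log_one_add_le {x : ℝ} (hx : |x| ≤ 1 / 2) : |Real.log (1 + x)| ≤ 2 * |x| := by
  have hx' := abs_le.mp hx
  have h1 : 0 < 1 + x := by linarith
  rw [abs_le]
  constructor
  · have := Real.one_sub_inv_le_log_of_pos h1
    have h2 : 1 - (1 + x)⁻¹ = x / (1 + x) := by field_simp; ring
    rw [h2] at this
    have h3 : -(2 * |x|) ≤ x / (1 + x) := by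
      rw [le_div_iff₀ h1]
      cases le_or_gt 0 x with
      | inl h => rw [abs_of_nonneg h]; nlinarith
      | inr h => rw [abs_of_neg h]; nlinarith
    linarith
  · have := Real.log_le_sub_one_of_pos h1
    linarith [le_abs_self x, abs_nonneg x]

/-- `|log ‖w‖ − log a| ≤ 2 ‖w − ia‖/a` when `‖w − ia‖ ≤ a/2` (`a > 0`): the modulus of a point near
`ia` on the logarithmic scale. [folklore] -/
theorem Soundararajan2004.abs_log_norm_sub_log_le {w : ℂ} {a : ℝ} (ha : 0 < a)
    (hw : ‖w - a * I‖ ≤ a / 2) : |Real.log ‖w‖ - Real.log a| ≤ 2 * ‖w - a * I‖ / a := by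
  have hia : ‖(a : ℂ) * I‖ = a := by simp [abs_of_pos ha]
  have hlow : a - ‖w - a * I‖ ≤ ‖w‖ := by
    have := norm_sub_norm_le ((a : ℂ) * I) w
    rw [hia, norm_sub_rev] at this; linarith
  have hup : ‖w‖ ≤ a + ‖w - a * I‖ := by
    have := norm_add_le ((a : ℂ) * I) (w - a * I)
    rw [hia, add_sub_cancel] at this; exact this
  have hw0 : 0 < ‖w‖ := by linarith [norm_nonneg (w - a * I)]
  set x : ℝ := (‖w‖ - a) / a with hx
  have hxeq : ‖w‖ = a * (1 + x) := by rw [hx]; field_simp; ring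
  have hxabs : |x| ≤ ‖w - a * I‖ / a := by
    rw [hx, abs_div, abs_of_pos ha]
    refine div_le_div_of_nonneg_right ?_ ha.le
    rw [abs_le]; constructor <;> linarith
  have hx2 : |x| ≤ 1 / 2 := hxabs.trans (by rw [div_le_iff₀ ha]; linarith)
  rw [hxeq, Real.log_mul ha.ne' (by linarith [(abs_le.mp hx2).1]), add_sub_cancel_left]
  calc |Real.log (1 + x)| ≤ 2 * |x| := Soundararajan2004.abs_log_one_add_le hx2
    _ ≤ 2 * (‖w - a * I‖ / a) := by linarith
    _ = 2 * ‖w - a * I‖ / a := by ring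

namespace SelbergDatum

open Literature.Analysis.SpecialFunctions.Complex

variable (D : SelbergDatum)

/-- **Stirling for one gamma factor on the critical line**: `Re ψ(λ(1/2 + iy) + μ) = log λ + log y + O(1/y)`
as `y → +∞` (from the second-order complex Stirling bound
`Literature.Analysis.SpecialFunctions.Complex.norm_digamma_sub_log_add_inv_le`). [folklore] -/
theorem exists_re_digamma_factor_sub_le (j : Fin D.numGamma) :
    ∃ C y₀ : ℝ, 0 < y₀ ∧ ∀ y : ℝ, y₀ ≤ y →
      |(digamma (D.lam j * (1 / 2 + y * I) + D.mu j)).re - Real.log (D.lam j) - Real.log y| ≤ C / y := by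
  have hl := D.lam_pos j
  set l : ℝ := D.lam j with hldef
  set μ : ℂ := D.mu j with hμdef
  -- `ρ₀ = ‖λ/2 + μ‖`: the distance of `w` from `iλy`
  set ρ₀ : ℝ := ‖(l : ℂ) / 2 + μ‖ with hρ₀
  have hρ₀0 : 0 ≤ ρ₀ := norm_nonneg _
  refine ⟨(2 * ρ₀ + 6) / l, max 1 (max (2 * (|μ.im| + 1) / l) (4 * ρ₀ / l)), by positivity, fun y hy ↦ ?_⟩
  have hy1 : 1 ≤ y := le_trans (le_max_left _ _) hy
  have hy0 : 0 < y := by linarith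
  have hy2 : 2 * (|μ.im| + 1) / l ≤ y := le_trans ((le_max_left _ _).trans (le_max_right _ _)) hy
  have hy3 : 4 * ρ₀ / l ≤ y := le_trans ((le_max_right _ _).trans (le_max_right _ _)) hy
  set w : ℂ := (l : ℂ) * (1 / 2 + y * I) + μ with hw
  have hwre : w.re = l / 2 + μ.re := by simp [hw]; ring
  have hwim : w.im = l * y + μ.im := by simp [hw]
  have hly : 2 * (|μ.im| + 1) ≤ l * y := by rw [div_le_iff₀ hl] at hy2; linarith
  have hwim1 : 1 ≤ w.im := by rw [hwim]; linarith [neg_abs_le μ.im, abs_nonneg μ.im]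
  have hwim2 : l * y / 2 ≤ w.im := by rw [hwim]; linarith [neg_abs_le μ.im, abs_nonneg μ.im]
  have hwre0 : 0 < w.re := by rw [hwre]; linarith [D.mu_re_nonneg j]
  -- Stirling
  have hS := norm_digamma_sub_log_add_inv_le hwre0 (by linarith)
  have herr : ‖digamma w - Complex.log w + 1 / (2 * w)‖ ≤ 2 / w.im := by
    refine hS.trans ?_
    rw [abs_of_pos (by linarith)]
    have h1 : 1 / (6 * w.im ^ 3) ≤ 1 / (6 * w.im) := by
      apply one_div_le_one_div_of_le (by positivity); nlinarith [hwim1]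
    have h2 : Real.pi / (12 * w.im ^ 2) ≤ Real.pi / (12 * w.im) := by
      apply div_le_div_of_nonneg_left Real.pi_pos.le (by positivity); nlinarith [hwim1]
    have h3 : 2 * (1 / (6 * w.im) + Real.pi / (12 * w.im)) ≤ 2 / w.im := by
      rw [div_add_div _ _ (by positivity) (by positivity), ← mul_div_assoc, div_le_div_iff₀ (by positivity) (by positivity)]
      nlinarith [Real.pi_lt_four, hwim1]
    linarith
  -- `|Re ψ(w) − log ‖w‖| ≤ 1/(2‖w‖)... ≤ 1/w.im + 2/w.im`
  have hw0 : w ≠ 0 := fun h ↦ by rw [h] at hwim1; simp at hwim1; linarith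
  have hwnorm : w.im ≤ ‖w‖ := by have := Complex.abs_im_le_norm w; rwa [abs_of_pos (by linarith)] at this
  have hre1 : |(digamma w).re - Real.log ‖w‖| ≤ 3 / w.im := by
    have h1 : |(digamma w - Complex.log w + 1 / (2 * w)).re| ≤ 2 / w.im :=
      (Complex.abs_re_le_norm _).trans herr
    rw [Complex.add_re, Complex.sub_re, Complex.log_re] at h1
    have h2 : |(1 / (2 * w)).re| ≤ 1 / w.im := by
      refine (Complex.abs_re_le_norm _).trans ?_
      rw [norm_div, norm_one, norm_mul, Complex.norm_two]
      rw [div_le_div_iff₀ (by positivity) (by linarith)]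
      nlinarith
    have e3 : (3 : ℝ) / w.im = 2 / w.im + 1 / w.im := by ring
    rw [abs_le] at h1 h2 ⊢
    rw [e3]
    constructor <;> linarith [h1.1, h1.2, h2.1, h2.2]
  -- `|log ‖w‖ − log (l y)| ≤ 2 ρ₀/(l y)`
  have hdist : ‖w - (l * y : ℝ) * I‖ = ρ₀ := by
    rw [hρ₀]; congr 1; rw [hw]; push_cast; ring
  have hre2 : |Real.log ‖w‖ - Real.log (l * y)| ≤ 2 * ρ₀ / (l * y) := by
    have hly0 : 0 < l * y := by positivity
    have h := Soundararajan2004.abs_log_norm_sub_log_le (w := w) hly0 (by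
      rw [hdist]; rw [div_le_iff₀ hl] at hy3; linarith)
    rwa [hdist] at h
  -- combine
  rw [Real.log_mul hl.ne' hy0.ne'] at hre2
  have hwiminv : 1 / w.im ≤ 2 / (l * y) := by
    rw [div_le_div_iff₀ (by linarith) (by positivity)]; linarith
  have h3w : 3 / w.im ≤ 6 / (l * y) := by
    have := mul_le_mul_of_nonneg_left hwiminv (by norm_num : (0 : ℝ) ≤ 3)
    calc 3 / w.im = 3 * (1 / w.im) := by ring
      _ ≤ 3 * (2 / (l * y)) := this
      _ = 6 / (l * y) := by ring
  have htri := abs_sub_le ((digamma w).re) (Real.log ‖w‖) (Real.log l + Real.log y)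
  rw [show (digamma w).re - Real.log l - Real.log y = (digamma w).re - (Real.log l + Real.log y) by ring]
  refine htri.trans ?_
  calc |(digamma w).re - Real.log ‖w‖| + |Real.log ‖w‖ - (Real.log l + Real.log y)|
      ≤ 6 / (l * y) + 2 * ρ₀ / (l * y) := add_le_add (hre1.trans h3w) hre2
    _ ≤ ((2 * ρ₀ + 6) / l) / y := by
        rw [← add_div, div_le_div_iff₀ (by positivity) hy0]
        have : ((2 * ρ₀ + 6) / l) * (l * y) = (6 + 2 * ρ₀) * y := by field_simp; ring
        rw [this]

/-- **Stirling for the gamma factor of `F ∈ 𝒮` on the critical line**: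
`Re ∑ⱼ λⱼ ψ(λⱼ(1/2 + iy) + μⱼ) = ∑ⱼ λⱼ log λⱼ + (d_F/2) log y + O(1/y)` as `y → +∞`. This is the
computation behind (8) of the source ("Stirling's formula shows that `H_F(t,L) = g(0) d_F log T/L + O(1/L)`").
[cite: Soundararajan2002, (8)] -/
theorem exists_re_sum_digamma_sub_le :
    ∃ C y₀ : ℝ, 0 < y₀ ∧ ∀ y : ℝ, y₀ ≤ y →
      |(∑ j, (D.lam j : ℂ) * digamma (D.lam j * (1 / 2 + y * I) + D.mu j)).re -
        (∑ j, D.lam j * Real.log (D.lam j)) - D.degree / 2 * Real.log y| ≤ C / y := by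
  choose Cj y₀j hy₀j hj using D.exists_re_digamma_factor_sub_le
  have hsum0 : 0 ≤ ∑ j, y₀j j := Finset.sum_nonneg fun i _ ↦ (hy₀j i).le
  refine ⟨∑ j, D.lam j * |Cj j|, (∑ j, y₀j j) + 1, by linarith, fun y hy ↦ ?_⟩
  have hyj : ∀ j, y₀j j ≤ y := fun j ↦ by
    have : y₀j j ≤ ∑ i, y₀j i := Finset.single_le_sum (f := y₀j) (fun i _ ↦ (hy₀j i).le) (Finset.mem_univ j)
    linarith
  have hy0 : 0 < y := by
    have : 0 ≤ ∑ i, y₀j i := Finset.sum_nonneg fun i _ ↦ (hy₀j i).le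
    linarith
  have hdeg : D.degree / 2 = ∑ j, D.lam j := by simp [degree]
  rw [hdeg, Complex.re_sum, Finset.sum_mul, ← Finset.sum_sub_distrib, ← Finset.sum_sub_distrib]
  have hterm : ∀ j, |((D.lam j : ℂ) * digamma (D.lam j * (1 / 2 + y * I) + D.mu j)).re -
      D.lam j * Real.log (D.lam j) - D.lam j * Real.log y| ≤ D.lam j * |Cj j| / y := by
    intro j
    rw [Complex.re_ofReal_mul, show D.lam j * (digamma (↑(D.lam j) * (1 / 2 + ↑y * I) + D.mu j)).re -
      D.lam j * Real.log (D.lam j) - D.lam j * Real.log y = D.lam j * ((digamma (↑(D.lam j) * (1 / 2 + ↑y * I) + D.mu j)).re -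
      Real.log (D.lam j) - Real.log y) by ring, abs_mul, abs_of_pos (D.lam_pos j), mul_div_assoc]
    refine mul_le_mul_of_nonneg_left ((hj j y (hyj j)).trans ?_) (D.lam_pos j).le
    exact div_le_div_of_nonneg_right (le_abs_self _) hy0.le
  calc |∑ j, (((D.lam j : ℂ) * digamma (D.lam j * (1 / 2 + y * I) + D.mu j)).re -
        D.lam j * Real.log (D.lam j) - D.lam j * Real.log y)|
      ≤ ∑ j, |((D.lam j : ℂ) * digamma (D.lam j * (1 / 2 + y * I) + D.mu j)).re -
        D.lam j * Real.log (D.lam j) - D.lam j * Real.log y| := Finset.abs_sum_le_sum_abs _ _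
    _ ≤ ∑ j, D.lam j * |Cj j| / y := Finset.sum_le_sum fun j _ ↦ hterm j
    _ = (∑ j, D.lam j * |Cj j|) / y := by rw [Finset.sum_div]

end SelbergDatum

namespace Soundararajan2004

/-- Change of variables `y = t₀ + u/L` against the scaled kernel:
`∫ φ(y) k(L(y − t₀)) dy = L⁻¹ ∫ φ(t₀ + u/L) k(u) du` (`L > 0`). [folklore] -/
theorem integral_mul_scaled_eq {φ : ℝ → ℂ} {k : ℂ → ℂ} {L : ℝ} (hL : 0 < L) (t₀ : ℝ) :
    ∫ y : ℝ, φ y * k ((L : ℂ) * ((y : ℂ) - t₀)) = (L⁻¹ : ℂ) * ∫ u : ℝ, φ (t₀ + u / L) * k u := by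
  have h1 := MeasureTheory.Measure.integral_comp_mul_left (fun u : ℝ ↦ φ (t₀ + u / L) * k u) L
  have h2 : (fun y : ℝ ↦ φ (t₀ + L * y / L) * k ((L * y : ℝ) : ℂ)) = fun y : ℝ ↦ φ (y + t₀) * k ((L : ℂ) * (y : ℂ)) := by
    funext y; rw [mul_div_cancel_left₀ _ hL.ne', add_comm]; push_cast; rfl
  rw [h2, abs_of_pos (inv_pos.mpr hL), Complex.real_smul] at h1
  push_cast at h1
  rw [← h1, ← integral_add_right_eq_self (μ := volume) (fun y : ℝ ↦ φ y * k ((L : ℂ) * ((y : ℂ) - t₀))) t₀]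
  congr 1; funext y; push_cast; ring_nf

/-- `1 + |u| + |u| log(1 + |u|) ≤ (1 + |u|)²`. [folklore] -/
theorem one_add_abs_add_mul_log_le (u : ℝ) : 1 + |u| + |u| * Real.log (1 + |u|) ≤ (1 + |u|) ^ 2 := by
  have h0 : 0 ≤ |u| := abs_nonneg u
  have h1 : Real.log (1 + |u|) ≤ |u| := by
    have := Real.log_le_sub_one_of_pos (by linarith : 0 < 1 + |u|); linarith
  nlinarith [mul_le_mul_of_nonneg_left h1 h0]

section Pair

variable {h : ℂ → ℂ} {Ch : ℝ} {N : ℕ}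

set_option maxHeartbeats 1600000 in
/-- **The gamma-factor term of the pair explicit formula, (8) of the source**: with
`G(s) = ∑ⱼ λⱼψ(λⱼs+μⱼ) − ∑ₖ λ'ₖψ(λ'ₖs+μ'ₖ)`, `κ = ∑ⱼ λⱼ log λⱼ − ∑ₖ λ'ₖ log λ'ₖ` and a real-on-`ℝ`
test function `h` with `‖h(z)‖ ≤ C e^{|im z|}/(1+|re z|)^N`, `N ≥ 4`: for `T ≥ T₀`, `L ≥ 1`, `t₀ ∈ [T, 2T]`,

  `| L · Re ∫ G(1/2 + iy) h(L(y − t₀)) dy − (∫ h) · ((d_F − d_G)/2 · log t₀ + κ) | ≤ C'/T`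

("Stirling's formula shows that `H_F(t, L) = g(0) d_F log T / L + O(1/L)`", (8); here with the
secondary main term `κ` kept and the error `O(1/T)`). [cite: Soundararajan2002, (8)] -/
theorem exists_gammaTerm_integral_sub_main_le (D₁ D₂ : SelbergDatum)
    (hh : Differentiable ℂ h) (hb : ∀ z : ℂ, ‖h z‖ ≤ Ch * Real.exp |z.im| / (1 + |z.re|) ^ N) (hN : 4 ≤ N)
    (hreal : ∀ u : ℝ, (h u).im = 0) :
    ∃ C T₀ : ℝ, 0 < T₀ ∧ ∀ (T L t₀ : ℝ), T₀ ≤ T → 1 ≤ L → T ≤ t₀ → t₀ ≤ 2 * T →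
      |L * (∫ y : ℝ, ((∑ j, (D₁.lam j : ℂ) * digamma (D₁.lam j * (1 / 2 + y * I) + D₁.mu j)) -
          (∑ j, (D₂.lam j : ℂ) * digamma (D₂.lam j * (1 / 2 + y * I) + D₂.mu j))) * h ((L : ℂ) * ((y : ℂ) - t₀))).re -
        (∫ u : ℝ, (h u).re) * ((D₁.degree - D₂.degree) / 2 * Real.log t₀ +
          ((∑ j, D₁.lam j * Real.log (D₁.lam j)) - ∑ j, D₂.lam j * Real.log (D₂.lam j)))| ≤ C / T := by
  -- data constants
  obtain ⟨C₁, y₁, hy₁, hS₁⟩ := D₁.exists_re_sum_digamma_sub_le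
  obtain ⟨C₂, y₂, hy₂, hS₂⟩ := D₂.exists_re_sum_digamma_sub_le
  obtain ⟨Cψ₁, hCψ₁, hψ₁⟩ := D₁.exists_norm_sum_digamma_le
  obtain ⟨Cψ₂, hCψ₂, hψ₂⟩ := D₂.exists_norm_sum_digamma_le
  have hCh : 0 ≤ Ch := by
    have := (norm_nonneg _).trans (hb 0); simp at this; linarith
  -- abbreviations
  set Gd : ℝ → ℂ := fun y ↦ (∑ j, (D₁.lam j : ℂ) * digamma (D₁.lam j * (1 / 2 + y * I) + D₁.mu j)) -
      (∑ j, (D₂.lam j : ℂ) * digamma (D₂.lam j * (1 / 2 + y * I) + D₂.mu j)) with hGd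
  set dd : ℝ := (D₁.degree - D₂.degree) / 2 with hdd
  set κ : ℝ := (∑ j, D₁.lam j * Real.log (D₁.lam j)) - ∑ j, D₂.lam j * Real.log (D₂.lam j) with hκ
  set K : ℝ := 2 * (|C₁| + |C₂|) + 2 * |dd| + 2 * (Cψ₁ + Cψ₂) * 4 + 2 * (|dd| * 3 + |κ|) with hK
  have hK0 : 0 ≤ K := by rw [hK]; positivity
  set J : ℝ := ∫ u : ℝ, 1 / (1 + |u|) ^ (N - 2) with hJ
  have hJ0 : 0 ≤ J := integral_nonneg fun u ↦ by positivity
  refine ⟨K * Ch * J, max (2 * max y₁ y₂) 2, by positivity, fun T L t₀ hT hL ht₁ ht₂ ↦ ?_⟩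
  have hT2 : 2 ≤ T := le_trans (le_max_right _ _) hT
  have hT0 : 0 < T := by linarith
  have hTy : 2 * max y₁ y₂ ≤ T := le_trans (le_max_left _ _) hT
  have hL0 : 0 < L := by linarith
  have ht0 : 0 < t₀ := by linarith
  -- Step 1: substitution and real part
  have hsub := integral_mul_scaled_eq (φ := Gd) (k := h) hL0 t₀
  have hGdc : Continuous Gd := by
    have hc : ∀ (D : SelbergDatum), Continuous fun y : ℝ ↦
        ∑ j, (D.lam j : ℂ) * digamma (D.lam j * (1 / 2 + y * I) + D.mu j) := by
      intro D
      refine continuous_finsetSum _ fun j _ ↦ continuous_const.mul ?_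
      refine (Literature.Analysis.SpecialFunctions.Complex.continuousOn_digamma.comp_continuous
        (by fun_prop) fun y ↦ ?_)
      simp only [Set.mem_setOf_eq, SelbergDatum.re_lam_mul_add]
      simp
      nlinarith [D.lam_pos j, D.mu_re_nonneg j]
    exact (hc D₁).sub (hc D₂)
  have hGdb : ∀ y : ℝ, ‖Gd y‖ ≤ (Cψ₁ + Cψ₂) * (Real.log (2 + |y|) + 1) := by
    intro y
    have h1 := hψ₁ (1 / 2 + y * I) (by simp; norm_num) (by simp; norm_num)
    have h2 := hψ₂ (1 / 2 + y * I) (by simp; norm_num) (by simp; norm_num)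
    simp only [add_im, div_ofNat_im, one_im, zero_div, mul_im, ofReal_re, I_im, mul_one, ofReal_im,
      I_re, mul_zero, add_zero, zero_add] at h1 h2
    calc ‖Gd y‖ ≤ _ := norm_sub_le _ _
      _ ≤ (Cψ₁ * Real.log (2 + |y|) + Cψ₁) + (Cψ₂ * Real.log (2 + |y|) + Cψ₂) := add_le_add h1 h2
      _ = (Cψ₁ + Cψ₂) * (Real.log (2 + |y|) + 1) := by ring
  -- the integrand `u ↦ Gd(t₀ + u/L) h(u)` is integrable
  have epow : ∀ u : ℝ, (1 + |u|) ^ 2 * (Ch / (1 + |u|) ^ N) = Ch / (1 + |u|) ^ (N - 2) := by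
    intro u
    have h1 : (0 : ℝ) < 1 + |u| := by positivity
    have : (1 + |u|) ^ N = (1 + |u|) ^ (N - 2) * (1 + |u|) ^ 2 := by rw [← pow_add]; congr 1; omega
    rw [this]; field_simp
  have hmaj : Integrable fun u : ℝ ↦ (1 + |u|) ^ 2 * (Ch / (1 + |u|) ^ N) := by
    have hI := integrable_one_add_norm (E := ℝ) (μ := volume) (r := ((N - 2 : ℕ) : ℝ))
      (by simp; exact_mod_cast (by omega : 1 < N - 2))
    refine (hI.const_mul Ch).congr (ae_of_all _ fun u ↦ ?_)
    simp only [Real.norm_eq_abs]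
    rw [epow, Real.rpow_neg (by positivity), Real.rpow_natCast, div_eq_mul_inv]
  -- Step 2: pointwise bound for the bracket
  have hbr : ∀ u : ℝ, |(Gd (t₀ + u / L)).re - (dd * Real.log t₀ + κ)| ≤ K / T * (1 + |u|) ^ 2 := by
    intro u
    set y : ℝ := t₀ + u / L with hy
    have hKT : 0 ≤ K / T := by positivity
    rcases le_or_gt |u| (L * T / 2) with hsmall | hlarge
    · -- `|u| ≤ LT/2`: Stirling at `y ∈ [T/2, 5T/2]`
      have huL : |u / L| ≤ T / 2 := by
        rw [abs_div, abs_of_pos hL0, div_le_iff₀ hL0]; linarith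
      have hyT : T / 2 ≤ y := by rw [hy]; linarith [(abs_le.mp huL).1]
      have hy0 : 0 < y := by linarith
      have hyy₁ : y₁ ≤ y := by linarith [le_max_left y₁ y₂]
      have hyy₂ : y₂ ≤ y := by linarith [le_max_right y₁ y₂]
      have h1 := hS₁ y hyy₁
      have h2 := hS₂ y hyy₂
      have hGre : (Gd y).re = (∑ j, (D₁.lam j : ℂ) * digamma (D₁.lam j * (1 / 2 + y * I) + D₁.mu j)).re -
          (∑ j, (D₂.lam j : ℂ) * digamma (D₂.lam j * (1 / 2 + y * I) + D₂.mu j)).re := by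
        simp [hGd]
      -- Stirling for the difference
      have hst : |(Gd y).re - κ - dd * Real.log y| ≤ (|C₁| + |C₂|) / y := by
        rw [hGre, hκ, hdd]
        have e : ∀ (a b c a' b' c' : ℝ), a - a' - (b - b') - (c - c') / 2 * Real.log y =
            (a - b - c / 2 * Real.log y) - (a' - b' - c' / 2 * Real.log y) := fun _ _ _ _ _ _ ↦ by ring
        rw [e]
        refine (abs_sub _ _).trans ?_
        rw [add_div]
        exact add_le_add (h1.trans (div_le_div_of_nonneg_right (le_abs_self _) hy0.le))
          (h2.trans (div_le_div_of_nonneg_right (le_abs_self _) hy0.le))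
      have hst' : |(Gd y).re - κ - dd * Real.log y| ≤ 2 * (|C₁| + |C₂|) / T := by
        refine hst.trans ?_
        rw [div_le_div_iff₀ hy0 hT0]; nlinarith [abs_nonneg C₁, abs_nonneg C₂]
      -- `log y − log t₀`
      have hx : |u / L / t₀| ≤ 1 / 2 := by
        rw [abs_div, abs_of_pos ht0, div_le_iff₀ ht0]; linarith
      have hlog : |Real.log y - Real.log t₀| ≤ 2 * |u| / T := by
        have hyeq : y = t₀ * (1 + u / L / t₀) := by rw [hy]; field_simp
        rw [hyeq, Real.log_mul ht0.ne' (by linarith [(abs_le.mp hx).1]), add_sub_cancel_left]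
        refine (abs_log_one_add_le hx).trans ?_
        rw [abs_div, abs_div, abs_of_pos hL0, abs_of_pos ht0, div_div, le_div_iff₀ hT0]
        rw [div_eq_mul_inv]
        have : |u| * (L * t₀)⁻¹ * T ≤ |u| := by
          rw [mul_assoc]
          refine mul_le_of_le_one_right (abs_nonneg u) ?_
          rw [inv_mul_le_iff₀ (by positivity)]; nlinarith
        linarith
      have hmid : |dd * Real.log y - dd * Real.log t₀| ≤ 2 * |dd| * |u| / T := by
        rw [← mul_sub, abs_mul]
        calc |dd| * |Real.log y - Real.log t₀| ≤ |dd| * (2 * |u| / T) :=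
              mul_le_mul_of_nonneg_left hlog (abs_nonneg _)
          _ = 2 * |dd| * |u| / T := by ring
      have htot : |(Gd y).re - (dd * Real.log t₀ + κ)| ≤ (2 * (|C₁| + |C₂|) + 2 * |dd| * |u|) / T := by
        have := abs_add_le ((Gd y).re - κ - dd * Real.log y) (dd * Real.log y - dd * Real.log t₀)
        rw [show (Gd y).re - κ - dd * Real.log y + (dd * Real.log y - dd * Real.log t₀) =
          (Gd y).re - (dd * Real.log t₀ + κ) by ring] at this
        rw [add_div]
        linarith
      refine htot.trans ?_
      rw [div_le_iff₀ hT0] at *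
      rw [show K / T * (1 + |u|) ^ 2 * T = K * (1 + |u|) ^ 2 by field_simp]
      have hu0 := abs_nonneg u
      have hK1 : 2 * (|C₁| + |C₂|) ≤ K := by rw [hK]; nlinarith [abs_nonneg dd, abs_nonneg κ]
      have hK2 : 2 * |dd| ≤ K := by rw [hK]; nlinarith [abs_nonneg C₁, abs_nonneg C₂, abs_nonneg κ, abs_nonneg dd]
      nlinarith [mul_le_mul_of_nonneg_right hK2 hu0, sq_nonneg (|u|)]
    · -- `|u| > LT/2 ≥ T/2`: crude bounds, times `2|u|/T ≥ 1`
      have huT : T / 2 ≤ |u| := by nlinarith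
      have hratio : 1 ≤ 2 * |u| / T := by rw [le_div_iff₀ hT0]; linarith
      have hyabs : |y| ≤ 5 * |u| := by
        rw [hy]
        refine (abs_add_le _ _).trans ?_
        rw [abs_of_pos ht0, abs_div, abs_of_pos hL0]
        have : |u| / L ≤ |u| := div_le_self (abs_nonneg u) hL
        linarith
      have hlog1 : Real.log (2 + |y|) ≤ 2 + Real.log (1 + |u|) := by
        have h5 : 2 + |y| ≤ 5 * (1 + |u|) := by linarith
        calc Real.log (2 + |y|) ≤ Real.log (5 * (1 + |u|)) :=
              Real.log_le_log (by linarith [abs_nonneg y]) h5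
          _ = Real.log 5 + Real.log (1 + |u|) := Real.log_mul (by norm_num) (by linarith [abs_nonneg u])
          _ ≤ 2 + Real.log (1 + |u|) := by
              have : Real.log 5 ≤ 2 := by
                rw [Real.log_le_iff_le_exp (by norm_num)]
                have := Real.add_one_le_exp 2  -- weak; use `exp 2 ≥ e² > 7`
                nlinarith [Real.exp_one_gt_d9, Real.exp_pos 1, show Real.exp 2 = Real.exp 1 * Real.exp 1 by rw [← Real.exp_add]; norm_num]
              linarith
      have hlogt : Real.log t₀ ≤ 2 + Real.log (1 + |u|) := by
        have : t₀ ≤ 4 * (1 + |u|) := by linarith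
        calc Real.log t₀ ≤ Real.log (4 * (1 + |u|)) := Real.log_le_log ht0 this
          _ = Real.log 4 + Real.log (1 + |u|) := Real.log_mul (by norm_num) (by linarith [abs_nonneg u])
          _ ≤ 2 + Real.log (1 + |u|) := by
              have : Real.log 4 ≤ 2 := by
                rw [Real.log_le_iff_le_exp (by norm_num)]
                nlinarith [Real.exp_one_gt_d9, Real.exp_pos 1, show Real.exp 2 = Real.exp 1 * Real.exp 1 by rw [← Real.exp_add]; norm_num]
              linarith
      have hlogt0 : 0 ≤ Real.log t₀ := Real.log_nonneg (by linarith)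
      have hlu0 : 0 ≤ Real.log (1 + |u|) := Real.log_nonneg (by linarith [abs_nonneg u])
      have hG := hGdb y
      have hGre : |(Gd y).re| ≤ (Cψ₁ + Cψ₂) * (3 + Real.log (1 + |u|)) := by
        refine (Complex.abs_re_le_norm _).trans (hG.trans ?_)
        apply mul_le_mul_of_nonneg_left _ (by positivity); linarith
      have hmain : |dd * Real.log t₀ + κ| ≤ |dd| * (2 + Real.log (1 + |u|)) + |κ| := by
        refine (abs_add_le _ _).trans (add_le_add ?_ le_rfl)
        rw [abs_mul, abs_of_nonneg hlogt0]
        exact mul_le_mul_of_nonneg_left hlogt (abs_nonneg _)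
      have hB : |(Gd y).re - (dd * Real.log t₀ + κ)| ≤
          (3 * (Cψ₁ + Cψ₂) + 2 * |dd| + |κ|) + (Cψ₁ + Cψ₂ + |dd|) * Real.log (1 + |u|) := by
        have := abs_sub ((Gd y).re) (dd * Real.log t₀ + κ)
        nlinarith [hGre, hmain]
      -- multiply by `2|u|/T ≥ 1`
      have hu0 := abs_nonneg u
      set A : ℝ := 3 * (Cψ₁ + Cψ₂) + 2 * |dd| + |κ| with hA
      set B' : ℝ := Cψ₁ + Cψ₂ + |dd| with hB'
      have hA0 : 0 ≤ A := by positivity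
      have hB'0 : 0 ≤ B' := by positivity
      have hstep : A + B' * Real.log (1 + |u|) ≤ (A + B' * Real.log (1 + |u|)) * (2 * |u| / T) :=
        le_mul_of_one_le_right (by positivity) hratio
      have hKA : 2 * A ≤ K := by rw [hK, hA]; linarith [abs_nonneg C₁, abs_nonneg C₂, abs_nonneg dd, hCψ₁, hCψ₂]
      have hKB : 2 * B' ≤ K := by rw [hK, hB']; linarith [abs_nonneg C₁, abs_nonneg C₂, abs_nonneg κ, abs_nonneg dd, hCψ₁, hCψ₂]
      refine hB.trans (hstep.trans ?_)
      rw [show (A + B' * Real.log (1 + |u|)) * (2 * |u| / T) = (2 * A * |u| + 2 * B' * (|u| * Real.log (1 + |u|))) / T by ring,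
        show K / T * (1 + |u|) ^ 2 = K * (1 + |u|) ^ 2 / T by ring]
      refine div_le_div_of_nonneg_right ?_ hT0.le
      have hsq := one_add_abs_add_mul_log_le u
      nlinarith [mul_le_mul_of_nonneg_right hKA hu0, mul_le_mul_of_nonneg_right hKB (mul_nonneg hu0 hlu0),
        mul_nonneg hK0 (by nlinarith : (0 : ℝ) ≤ (1 + |u|) ^ 2 - |u| - |u| * Real.log (1 + |u|))]
  -- Step 3: integrability
  have hhre : ∀ u : ℝ, ‖h u‖ ≤ Ch / (1 + |u|) ^ N := fun u ↦ by simpa using hb u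
  have hint_h : Integrable fun u : ℝ ↦ h u := by
    refine hmaj.mono' (hh.continuous.comp continuous_ofReal).aestronglyMeasurable (ae_of_all _ fun u ↦ ?_)
    refine (hhre u).trans ?_
    have : 1 ≤ (1 + |u|) ^ 2 := one_le_pow₀ (by linarith [abs_nonneg u])
    exact le_mul_of_one_le_left (by positivity) this
  have hint_hre : Integrable fun u : ℝ ↦ (h u).re := hint_h.re
  have hGc2 : Continuous fun u : ℝ ↦ Gd (t₀ + u / L) := hGdc.comp (by fun_prop)
  have hint_prod : Integrable fun u : ℝ ↦ Gd (t₀ + u / L) * h u := by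
    refine (hmaj.const_mul ((Cψ₁ + Cψ₂) * (2 + 2 * T + 1))).mono'
      ((hGc2.mul (hh.continuous.comp continuous_ofReal)).aestronglyMeasurable) (ae_of_all _ fun u ↦ ?_)
    rw [norm_mul]
    have h1 := hGdb (t₀ + u / L)
    have hy : |t₀ + u / L| ≤ 2 * T + |u| := by
      refine (abs_add_le _ _).trans ?_
      rw [abs_of_pos ht0, abs_div, abs_of_pos hL0]
      linarith [div_le_self (abs_nonneg u) hL]
    have hlog : Real.log (2 + |t₀ + u / L|) + 1 ≤ (2 + 2 * T + 1) * (1 + |u|) ^ 2 := by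
      have hl : Real.log (2 + |t₀ + u / L|) ≤ 2 + |t₀ + u / L| - 1 := Real.log_le_sub_one_of_pos (by linarith [abs_nonneg (t₀ + u / L)])
      have hu0 := abs_nonneg u
      have h3 : Real.log (2 + |t₀ + u / L|) + 1 ≤ (2 + 2 * T + 1) * (1 + |u|) := by nlinarith
      have h4 : (2 + 2 * T + 1) * (1 + |u|) ≤ (2 + 2 * T + 1) * (1 + |u|) ^ 2 := by
        apply mul_le_mul_of_nonneg_left _ (by linarith); nlinarith
      linarith
    have hlognn : 0 ≤ Real.log (2 + |t₀ + u / L|) + 1 := by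
      linarith [Real.log_nonneg (show (1:ℝ) ≤ 2 + |t₀ + u / L| by linarith [abs_nonneg (t₀ + u / L)])]
    calc ‖Gd (t₀ + u / L)‖ * ‖h u‖ ≤ (Cψ₁ + Cψ₂) * (Real.log (2 + |t₀ + u / L|) + 1) * (Ch / (1 + |u|) ^ N) :=
          mul_le_mul h1 (hhre u) (norm_nonneg _) (mul_nonneg (by positivity) hlognn)
      _ ≤ (Cψ₁ + Cψ₂) * ((2 + 2 * T + 1) * (1 + |u|) ^ 2) * (Ch / (1 + |u|) ^ N) := by
          gcongr
      _ = (Cψ₁ + Cψ₂) * (2 + 2 * T + 1) * ((1 + |u|) ^ 2 * (Ch / (1 + |u|) ^ N)) := by ring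
  have hint_Gre : Integrable fun u : ℝ ↦ (Gd (t₀ + u / L)).re * (h u).re := by
    have := hint_prod.re
    refine this.congr (ae_of_all _ fun u ↦ ?_)
    simp [hreal u]
  -- Step 4: assemble
  rw [hsub]
  have hreL : L * (((L⁻¹ : ℝ) : ℂ) * ∫ u : ℝ, Gd (t₀ + u / L) * h u).re = (∫ u : ℝ, Gd (t₀ + u / L) * h u).re := by
    rw [Complex.re_ofReal_mul, ← mul_assoc, mul_inv_cancel₀ hL0.ne', one_mul]
  push_cast at hreL
  have hre_int : (∫ u : ℝ, Gd (t₀ + u / L) * h u).re = ∫ u : ℝ, (Gd (t₀ + u / L)).re * (h u).re := by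
    rw [show (∫ u : ℝ, Gd (t₀ + u / L) * h u).re = RCLike.re (∫ u : ℝ, Gd (t₀ + u / L) * h u) from rfl,
      ← integral_re hint_prod]
    exact integral_congr_ae (ae_of_all _ fun u ↦ by simp [hreal u])
  rw [hreL, hre_int, ← integral_mul_const, ← integral_sub hint_Gre (hint_hre.mul_const _)]
  rw [show (fun u : ℝ ↦ (Gd (t₀ + u / L)).re * (h u).re - (h u).re * (dd * Real.log t₀ + κ)) =
      fun u : ℝ ↦ ((Gd (t₀ + u / L)).re - (dd * Real.log t₀ + κ)) * (h u).re by funext u; ring]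
  calc |∫ u : ℝ, ((Gd (t₀ + u / L)).re - (dd * Real.log t₀ + κ)) * (h u).re|
      ≤ ∫ u : ℝ, |((Gd (t₀ + u / L)).re - (dd * Real.log t₀ + κ)) * (h u).re| := abs_integral_le_integral_abs
    _ ≤ ∫ u : ℝ, K / T * ((1 + |u|) ^ 2 * (Ch / (1 + |u|) ^ N)) := by
        refine integral_mono_of_nonneg (ae_of_all _ fun u ↦ abs_nonneg _) (hmaj.const_mul _) (ae_of_all _ fun u ↦ ?_)
        simp only
        rw [abs_mul]
        have h1 := hbr u
        have h2 : |(h u).re| ≤ Ch / (1 + |u|) ^ N := (Complex.abs_re_le_norm _).trans (hhre u)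
        calc |(Gd (t₀ + u / L)).re - (dd * Real.log t₀ + κ)| * |(h u).re|
            ≤ K / T * (1 + |u|) ^ 2 * (Ch / (1 + |u|) ^ N) := mul_le_mul h1 h2 (abs_nonneg _) (by positivity)
          _ = K / T * ((1 + |u|) ^ 2 * (Ch / (1 + |u|) ^ N)) := by ring
    _ = K / T * (Ch * J) := by
        rw [integral_const_mul]
        congr 1
        rw [hJ, ← integral_const_mul]
        exact integral_congr_ae (ae_of_all _ fun u ↦ by simp only; rw [epow]; ring)
    _ = K * Ch * J / T := by ring

end Pair
end Soundararajan2004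

namespace Soundararajan2004

open Literature.Analysis.Complex

section Shift

variable {h : ℂ → ℂ} {Ch : ℝ} {N : ℕ}

/-- `(1 + |y − t₀|)^{1−N}`-type majorant: for `N ≥ 3`, `y ↦ (1 + |y|)(1 + |y − t₀|)^{-N}·const` is
integrable; precisely `y ↦ (2 + |t₀| + 1) (1 + |y − t₀|) / (1 + |y − t₀|)^N`. [folklore] -/
theorem integrable_one_add_abs_div_pow (hN : 3 ≤ N) (t₀ c : ℝ) :
    Integrable fun y : ℝ ↦ c * ((1 + |y - t₀|) / (1 + |y - t₀|) ^ N) := by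
  have hI := integrable_one_add_norm (E := ℝ) (μ := volume) (r := ((N - 1 : ℕ) : ℝ))
    (by simp; exact_mod_cast (by omega : 1 < N - 1))
  have h1 : Integrable fun u : ℝ ↦ (1 + |u|) / (1 + |u|) ^ N := by
    refine hI.congr (ae_of_all _ fun u ↦ ?_)
    simp only [Real.norm_eq_abs]
    have h0 : (0 : ℝ) < 1 + |u| := by positivity
    rw [Real.rpow_neg h0.le, Real.rpow_natCast]
    have : (1 + |u|) ^ N = (1 + |u|) ^ (N - 1) * (1 + |u|) := by rw [← pow_succ]; congr 1; omega
    rw [this]; field_simp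
  exact (h1.comp_sub_right t₀).const_mul c

set_option maxHeartbeats 800000 in
/-- **Shifting the gamma-term integral to the critical line.** With `G(s) = ∑ⱼ λⱼψ(λⱼs+μⱼ) −
∑ₖ λ'ₖψ(λ'ₖs+μ'ₖ)` (analytic on `re s > 0`, `O(log |im s|)` near the line) and the kernel
`s ↦ h(−iL(s − 1/2) − Lt₀)`: for `0 ≤ η ≤ 1/4`, `L ≥ 1`,
`∫ G(1/2 + η + iy) h(L(y − t₀) − iLη) dy = ∫ G(1/2 + iy) h(L(y − t₀)) dy`
(`Literature.Analysis.Complex.integral_vertical_eq_of_differentiableOn`). This is the move from the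
contour of the explicit formula to the line `re s = 1/2` on which (8) of the source is stated.
[cite: Soundararajan2002, (7)–(8)] -/
theorem integral_gammaTerm_vertical_shift (D₁ D₂ : SelbergDatum)
    (hh : Differentiable ℂ h) (hb : ∀ z : ℂ, ‖h z‖ ≤ Ch * Real.exp |z.im| / (1 + |z.re|) ^ N) (hN : 3 ≤ N)
    {L η : ℝ} (hL : 1 ≤ L) (hη0 : 0 ≤ η) (hη : η ≤ 1 / 4) (t₀ : ℝ) :
    ∫ y : ℝ, ((∑ j, (D₁.lam j : ℂ) * digamma (D₁.lam j * (1 / 2 + η + y * I) + D₁.mu j)) -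
        (∑ j, (D₂.lam j : ℂ) * digamma (D₂.lam j * (1 / 2 + η + y * I) + D₂.mu j))) *
        h ((L : ℂ) * ((y : ℂ) - t₀) - L * η * I) =
      ∫ y : ℝ, ((∑ j, (D₁.lam j : ℂ) * digamma (D₁.lam j * (1 / 2 + y * I) + D₁.mu j)) -
        (∑ j, (D₂.lam j : ℂ) * digamma (D₂.lam j * (1 / 2 + y * I) + D₂.mu j))) *
        h ((L : ℂ) * ((y : ℂ) - t₀)) := by
  obtain ⟨Cψ₁, hCψ₁, hψ₁⟩ := D₁.exists_norm_sum_digamma_le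
  obtain ⟨Cψ₂, hCψ₂, hψ₂⟩ := D₂.exists_norm_sum_digamma_le
  have hCh : 0 ≤ Ch := by
    have := (norm_nonneg _).trans (hb 0); simp at this; linarith
  have hL0 : 0 < L := by linarith
  -- the functions
  set Gs : ℂ → ℂ := fun s ↦ (∑ j, (D₁.lam j : ℂ) * digamma (D₁.lam j * s + D₁.mu j)) -
      (∑ j, (D₂.lam j : ℂ) * digamma (D₂.lam j * s + D₂.mu j)) with hGs
  set F : ℂ → ℂ := fun s ↦ Gs s * h (-I * L * (s - 1 / 2) - L * t₀) with hF
  -- `G` is differentiable on `re s > 0`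
  have hGd : ∀ s : ℂ, 0 < s.re → DifferentiableAt ℂ Gs s := by
    intro s hs
    have hterm : ∀ (D : SelbergDatum) (j : Fin D.numGamma),
        DifferentiableAt ℂ (fun z ↦ (D.lam j : ℂ) * digamma (D.lam j * z + D.mu j)) s := by
      intro D j
      refine (differentiableAt_const _).mul ?_
      have hw : 0 < ((D.lam j : ℂ) * s + D.mu j).re := by
        rw [SelbergDatum.re_lam_mul_add]; nlinarith [D.lam_pos j, D.mu_re_nonneg j]
      exact ((Literature.Analysis.SpecialFunctions.Complex.differentiableOn_digamma _ hw).differentiableAt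
        ((isOpen_lt continuous_const continuous_re).mem_nhds hw)).comp s (by fun_prop)
    simp only [hGs]
    exact (DifferentiableAt.fun_sum fun j _ ↦ hterm D₁ j).sub (DifferentiableAt.fun_sum fun j _ ↦ hterm D₂ j)
  have hGb : ∀ s : ℂ, 1 / 4 ≤ s.re → s.re ≤ 3 / 4 → ‖Gs s‖ ≤ (Cψ₁ + Cψ₂) * (Real.log (2 + |s.im|) + 1) := by
    intro s h1 h2
    calc ‖Gs s‖ ≤ _ := norm_sub_le _ _
      _ ≤ (Cψ₁ * Real.log (2 + |s.im|) + Cψ₁) + (Cψ₂ * Real.log (2 + |s.im|) + Cψ₂) :=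
          add_le_add (hψ₁ s h1 h2) (hψ₂ s h1 h2)
      _ = (Cψ₁ + Cψ₂) * (Real.log (2 + |s.im|) + 1) := by ring
  -- `F` is differentiable on the closed strip `1/2 ≤ re s ≤ 1/2 + η`
  have hFd : DifferentiableOn ℂ F (re ⁻¹' Icc (1 / 2) (1 / 2 + η)) := by
    intro s hs
    have hs0 : 0 < s.re := by have := hs.1; simp at this; linarith
    refine DifferentiableAt.differentiableWithinAt ?_
    simp only [hF]
    exact (hGd s hs0).mul ((hh _).comp s (by fun_prop))
  -- the bound for `F` on the strip `1/4 ≤ re s ≤ 3/4`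
  have hFb : ∀ s : ℂ, 1 / 2 ≤ s.re → s.re ≤ 1 / 2 + η →
      ‖F s‖ ≤ (Cψ₁ + Cψ₂) * Ch * Real.exp (L * η) * (2 + |t₀| + 1) *
        ((1 + |s.im - t₀|) / (1 + |s.im - t₀|) ^ N) := by
    intro s h1 h2
    have hG := hGb s (by linarith) (by linarith)
    have hk := hb (-I * L * (s - 1 / 2) - L * t₀)
    have hre : (-I * L * (s - 1 / 2) - L * t₀ : ℂ).re = L * (s.im - t₀) := by
      simp [Complex.mul_re, Complex.mul_im]; ring
    have him : (-I * L * (s - 1 / 2) - L * t₀ : ℂ).im = -(L * (s.re - 1 / 2)) := by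
      simp [Complex.mul_re, Complex.mul_im]
    rw [hre, him] at hk
    have hexp : Real.exp |-(L * (s.re - 1 / 2))| ≤ Real.exp (L * η) := by
      rw [abs_neg, abs_of_nonneg (by nlinarith)]; exact Real.exp_le_exp.mpr (by nlinarith)
    have hpow : (1 + |s.im - t₀|) ^ N ≤ (1 + |L * (s.im - t₀)|) ^ N := by
      apply pow_le_pow_left₀ (by positivity)
      rw [abs_mul, abs_of_pos hL0]; nlinarith [abs_nonneg (s.im - t₀)]
    have hk' : ‖h (-I * L * (s - 1 / 2) - L * t₀)‖ ≤ Ch * Real.exp (L * η) / (1 + |s.im - t₀|) ^ N := by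
      refine hk.trans ?_
      rw [div_le_div_iff₀ (by positivity) (by positivity)]
      exact mul_le_mul (mul_le_mul_of_nonneg_left hexp hCh) hpow (by positivity) (by positivity)
    have hlog : Real.log (2 + |s.im|) + 1 ≤ (2 + |t₀| + 1) * (1 + |s.im - t₀|) := by
      have hl : Real.log (2 + |s.im|) ≤ 2 + |s.im| - 1 := Real.log_le_sub_one_of_pos (by linarith [abs_nonneg s.im])
      have : |s.im| ≤ |t₀| + |s.im - t₀| := by
        have := abs_add_le t₀ (s.im - t₀); rwa [add_sub_cancel] at this
      nlinarith [abs_nonneg (s.im - t₀), abs_nonneg t₀]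
    simp only [hF, norm_mul]
    calc ‖Gs s‖ * ‖h (-I * L * (s - 1 / 2) - L * t₀)‖
        ≤ (Cψ₁ + Cψ₂) * (Real.log (2 + |s.im|) + 1) * (Ch * Real.exp (L * η) / (1 + |s.im - t₀|) ^ N) :=
          mul_le_mul hG hk' (norm_nonneg _) (mul_nonneg (by positivity)
            (by linarith [Real.log_nonneg (show (1:ℝ) ≤ 2 + |s.im| by linarith [abs_nonneg s.im])]))
      _ ≤ (Cψ₁ + Cψ₂) * ((2 + |t₀| + 1) * (1 + |s.im - t₀|)) * (Ch * Real.exp (L * η) / (1 + |s.im - t₀|) ^ N) := by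
          gcongr
      _ = (Cψ₁ + Cψ₂) * Ch * Real.exp (L * η) * (2 + |t₀| + 1) * ((1 + |s.im - t₀|) / (1 + |s.im - t₀|) ^ N) := by
          ring
  -- integrability on the two lines
  have hmaj := integrable_one_add_abs_div_pow hN t₀ ((Cψ₁ + Cψ₂) * Ch * Real.exp (L * η) * (2 + |t₀| + 1))
  have hFc : ∀ x : ℝ, 1 / 2 ≤ x → x ≤ 1 / 2 + η → Continuous fun y : ℝ ↦ F (x + y * I) := by
    intro x h1 h2
    have : ∀ y : ℝ, DifferentiableAt ℂ F ((x : ℂ) + y * I) := fun y ↦ by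
      have hs : 0 < ((x : ℂ) + y * I).re := by simp; linarith
      simp only [hF]
      exact (hGd _ hs).mul ((hh _).comp _ (by fun_prop))
    have hφ : Continuous fun y : ℝ ↦ (x : ℂ) + y * I := by fun_prop
    exact continuous_iff_continuousAt.mpr fun y ↦ (this y).continuousAt.comp_of_eq (hφ.continuousAt) rfl
  have hint : ∀ x : ℝ, 1 / 2 ≤ x → x ≤ 1 / 2 + η → Integrable fun y : ℝ ↦ F (x + y * I) := by
    intro x h1 h2
    refine hmaj.mono' (hFc x h1 h2).aestronglyMeasurable (ae_of_all _ fun y ↦ ?_)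
    have := hFb (x + y * I) (by simpa using h1) (by simpa using h2)
    simpa using this
  -- decay on horizontal segments
  have hdecay : ∀ ε : ℝ, 0 < ε → ∃ T₀ : ℝ, ∀ T : ℝ, T₀ ≤ |T| → ∀ x ∈ Icc (1 / 2 : ℝ) (1 / 2 + η), ‖F (x + T * I)‖ ≤ ε := by
    intro ε hε
    set K : ℝ := (Cψ₁ + Cψ₂) * Ch * Real.exp (L * η) * (2 + |t₀| + 1) with hK
    have hK0 : 0 ≤ K := by positivity
    refine ⟨|t₀| + (K / ε + 1), fun T hT x hx ↦ ?_⟩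
    have hFx := hFb (x + T * I) (by simpa using hx.1) (by simpa using hx.2)
    simp only [add_im, ofReal_im, mul_im, ofReal_re, I_im, mul_one, I_re, mul_zero, add_zero, zero_add] at hFx
    have hd : K / ε ≤ |T - t₀| := by
      have := abs_sub_abs_le_abs_sub T t₀; linarith
    have hq : (1 + |T - t₀|) / (1 + |T - t₀|) ^ N ≤ 1 / (1 + |T - t₀|) := by
      rw [div_le_div_iff₀ (by positivity) (by positivity), one_mul]
      have h2 : (1 + |T - t₀|) ^ 2 ≤ (1 + |T - t₀|) ^ N :=
        pow_le_pow_right₀ (by linarith [abs_nonneg (T - t₀)]) (by omega)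
      nlinarith
    refine hFx.trans ?_
    calc K * ((1 + |T - t₀|) / (1 + |T - t₀|) ^ N) ≤ K * (1 / (1 + |T - t₀|)) := mul_le_mul_of_nonneg_left hq hK0
      _ ≤ ε := by
          rw [← mul_div_assoc, mul_one, div_le_iff₀ (by positivity)]
          have : K ≤ ε * (K / ε) := by rw [mul_div_cancel₀ _ hε.ne']
          nlinarith [abs_nonneg (T - t₀)]
  -- the shift
  have key := integral_vertical_eq_of_differentiableOn (F := F) (a := 1 / 2) (b := 1 / 2 + η) (by linarith) hFd
    (hint _ le_rfl (by linarith)) (hint _ (by linarith) le_rfl) hdecay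
  -- identify both sides
  have lhs : ∀ y : ℝ, F ((1 / 2 + η : ℝ) + y * I) = ((∑ j, (D₁.lam j : ℂ) * digamma (D₁.lam j * (1 / 2 + η + y * I) + D₁.mu j)) -
      (∑ j, (D₂.lam j : ℂ) * digamma (D₂.lam j * (1 / 2 + η + y * I) + D₂.mu j))) *
      h ((L : ℂ) * ((y : ℂ) - t₀) - L * η * I) := by
    intro y
    simp only [hF, hGs]
    have e1 : ((1 / 2 + η : ℝ) : ℂ) + y * I = 1 / 2 + η + y * I := by push_cast; ring
    have e2 : -I * L * (((1 / 2 + η : ℝ) : ℂ) + y * I - 1 / 2) - L * t₀ = (L : ℂ) * ((y : ℂ) - t₀) - L * η * I := by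
      push_cast; ring_nf; rw [I_sq]; ring
    rw [e2, e1]
  have rhs : ∀ y : ℝ, F ((1 / 2 : ℝ) + y * I) = ((∑ j, (D₁.lam j : ℂ) * digamma (D₁.lam j * (1 / 2 + y * I) + D₁.mu j)) -
      (∑ j, (D₂.lam j : ℂ) * digamma (D₂.lam j * (1 / 2 + y * I) + D₂.mu j))) * h ((L : ℂ) * ((y : ℂ) - t₀)) := by
    intro y
    simp only [hF, hGs]
    have e1 : ((1 / 2 : ℝ) : ℂ) + y * I = 1 / 2 + y * I := by push_cast; ring
    have e2 : -I * L * (((1 / 2 : ℝ) : ℂ) + y * I - 1 / 2) - L * t₀ = (L : ℂ) * ((y : ℂ) - t₀) := by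
      push_cast; ring_nf; rw [I_sq]; ring
    rw [e2, e1]
  simp_rw [lhs, rhs] at key
  exact key.symm

end Shift
end Soundararajan2004
end Literature.NumberTheory.LFunctions

end
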